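import Summits.CriticalPhenomena.Ising3D.ExclusionSentencesPiForms
import Mathlib.Analysis.SpecialFunctions.Gamma.Basic
import Mathlib.Analysis.SpecialFunctions.ImproperIntegrals
import Mathlib.Analysis.SpecialFunctions.Integrals.Basic
import Mathlib.MeasureTheory.Integral.IntegralEqImproper
import Mathlib.Analysis.Calculus.Deriv.MeanValue

/-!
# Certified enclosures of `Γ(¼)` and `Γ(⅓)` (cell `pub-ising3x`, seat recog-1)

HONEST FRAMING: lottery ticket; floor = tightest certified 3D Ising CFT bounds; no exact-solution
claim without a proof.

The last two constants of the frozen family `TRG` of FAMILIES-v1 (`HOME/frozen/FAMILIES-v1.json`, SCOPE.md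
§3.1: monomials `(p/q)·u·π^(a/2)·Γ(¼)^b·Γ(⅓)^c·L^s`) without certified digits in Mathlib are `Γ(¼)` and
`Γ(⅓)`.  This file proves, from `Real.Gamma_eq_integral` and first principles (no numerics library, no
`native_decide`):
* `gamma_quarter_mem : Real.Gamma (1/4) ∈ [3.6256099082157, 3.6256099082221]` (width `6.4·10⁻¹²`),
* `gamma_third_mem  : Real.Gamma (1/3) ∈ [2.6789385347047, 2.6789385347079]` (width `3.2·10⁻¹²`),
as `ℚ × ℚ` pairs `gammaQuarterI`, `gammaThirdI` for the interval arithmetic (`InI`) of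
`ExclusionSentencesPiForms.lean`.
Method.  (1) `Γ(1/p) = p ∫_{(0,∞)} e^{−x^p} dx` (`Gamma_one_div_eq`: the substitution `y = x^p`,
`MeasureTheory.integral_comp_rpow_Ioi_of_pos`).  (2) Alternating Taylor brackets
`expT (2m) y ≤ e^{−y} ≤ expT (2m+1) y` for `y ≥ 0` (`exp_neg_brackets`; `expT n y = Σ_{k<n} (−y)^k/k!`, by
induction through the derivative `(expT (n+1))' = −expT n` and `monotoneOn_of_deriv_nonneg`).  (3) On
`[0, R]` the brackets integrate termwise to the finite sums `gSum p n R = Σ_{k<n} (−1)^k R^{pk+1}/((pk+1)k!)`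
(`integral_expT_pow`, `integral_exp_neg_pow_brackets`).  (4) The tail: `0 ≤ ∫_{(R,∞)} e^{−x^p} ≤
e^{−R^p}/(p R^{p−1})` (`integral_Ioi_exp_neg_pow_tail`: compare with the derivative of `−e^{−x^p}/(pR^{p−1})`,
`integral_Ioi_of_hasDerivAt_of_tendsto`), and `e^{−R^p} ≤ 1/Σ_{i<N} R^{pi}/i!` (`Real.sum_le_exp_of_nonneg`).
(5) Numerics in exact rationals decided by the kernel: `p = 4`, `R = 11/5`, orders `90/91`, `N = 60`;
`p = 3`, `R = 29/10`, orders `100/101`, `N = 64` (`gSumQ`, `expLowQ`; the sums have ≈ 460-digit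
numerators).  A negative control (lower end moved above the proved bound) fails at exactly that comparison.
With this file every constant of FAMILIES-v1 has a kernel-certified enclosure; the `Γ`-monomials of `TRG` get
their checker in `ExclusionSentencesTrgGamma.lean`.  No 3D digit is used anywhere.
-/

namespace Summit.CriticalPhenomena.Ising3D

open Real MeasureTheory Set Filter Topology Finset intervalIntegral

/-! ### Alternating Taylor bounds for `e^{−y}`, `y ≥ 0` -/

/-- `expT n y = Σ_{k<n} (−y)^k / k!`, the Taylor polynomial of `e^{−y}`. -/
noncomputable def expT (n : ℕ) (y : ℝ) : ℝ := ∑ k ∈ range n, (-y) ^ k / (k.factorial : ℝ)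

/-- `expT (n+1) 0 = 1`. -/
theorem expT_succ_zero (n : ℕ) : expT (n + 1) 0 = 1 := by
  induction n with
  | zero => simp [expT]
  | succ n ih =>
      unfold expT at ih ⊢
      rw [sum_range_succ, ih]
      simp

/-- `expT` is continuous. -/
theorem continuous_expT (n : ℕ) : Continuous (expT n) := by
  unfold expT
  fun_prop

/-- `d/dy expT (n+1) y = − expT n y`. -/
theorem hasDerivAt_expT (n : ℕ) (y : ℝ) : HasDerivAt (expT (n + 1)) (-expT n y) y := by
  induction n with
  | zero =>
      have : expT 1 = fun _ => (1 : ℝ) := by funext y; simp [expT]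
      rw [this]; simpa [expT] using hasDerivAt_const y (1 : ℝ)
  | succ n ih =>
      have e : expT (n + 2) = fun y => expT (n + 1) y + (-y) ^ (n + 1) / ((n + 1).factorial : ℝ) := by
        funext y; simp [expT, sum_range_succ]
      rw [e]
      have h1 : HasDerivAt (fun y : ℝ => (-y) ^ (n + 1) / ((n + 1).factorial : ℝ))
          ((((n + 1 : ℕ) : ℝ) * (-y) ^ (n + 1 - 1) * (-1)) / ((n + 1).factorial : ℝ)) y :=
        ((hasDerivAt_id y).neg.pow (n + 1)).div_const _
      have h2 := ih.add h1
      refine h2.congr_deriv ?_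
      simp only [expT, sum_range_succ, Nat.add_sub_cancel, Nat.factorial_succ]
      push_cast
      field_simp
      ring

/-- One step up: an upper Taylor bound of order `n` gives the lower bound of order `n+1`. -/
theorem expT_le_exp_of_exp_le (n : ℕ) (h : ∀ y : ℝ, 0 ≤ y → exp (-y) ≤ expT n y) :
    ∀ y : ℝ, 0 ≤ y → expT (n + 1) y ≤ exp (-y) := by
  intro y hy
  -- φ t = exp (−t) − expT (n+1) t is monotone on [0, ∞) and vanishes at 0
  let φ : ℝ → ℝ := fun t => exp (-t) - expT (n + 1) t
  have hderiv : ∀ t, HasDerivAt φ (-exp (-t) + expT n t) t := by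
    intro t
    have h1 : HasDerivAt (fun t => exp (-t)) (-exp (-t)) t := by
      simpa using ((hasDerivAt_id t).neg.exp)
    have h2 := h1.sub (hasDerivAt_expT n t)
    exact (show HasDerivAt φ (-exp (-t) - -expT n t) t from h2).congr_deriv (by ring)
  have hmono : MonotoneOn φ (Ici 0) := by
    refine monotoneOn_of_deriv_nonneg (convex_Ici 0) ?_ ?_ ?_
    · exact (HasDerivAt.continuousOn fun t _ => hderiv t)
    · exact fun t _ => (hderiv t).differentiableAt.differentiableWithinAt
    · intro t ht
      rw [interior_Ici] at ht
      rw [(hderiv t).deriv]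
      have := h t (le_of_lt ht)
      linarith
  have h0 : φ 0 = 0 := by simp [φ, expT_succ_zero]
  have := hmono (self_mem_Ici (a := (0 : ℝ))) (mem_Ici.mpr hy) hy
  rw [h0] at this
  simp only [φ] at this
  linarith

/-- One step up: a lower Taylor bound of order `n` gives the upper bound of order `n+1`. -/
theorem exp_le_expT_of_expT_le (n : ℕ) (h : ∀ y : ℝ, 0 ≤ y → expT n y ≤ exp (-y)) :
    ∀ y : ℝ, 0 ≤ y → exp (-y) ≤ expT (n + 1) y := by
  intro y hy
  let φ : ℝ → ℝ := fun t => expT (n + 1) t - exp (-t)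
  have hderiv : ∀ t, HasDerivAt φ (-expT n t + exp (-t)) t := by
    intro t
    have h1 : HasDerivAt (fun t => exp (-t)) (-exp (-t)) t := by
      simpa using ((hasDerivAt_id t).neg.exp)
    have h2 := (hasDerivAt_expT n t).sub h1
    exact (show HasDerivAt φ (-expT n t - -exp (-t)) t from h2).congr_deriv (by ring)
  have hmono : MonotoneOn φ (Ici 0) := by
    refine monotoneOn_of_deriv_nonneg (convex_Ici 0) ?_ ?_ ?_
    · exact (HasDerivAt.continuousOn fun t _ => hderiv t)
    · exact fun t _ => (hderiv t).differentiableAt.differentiableWithinAt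
    · intro t ht
      rw [interior_Ici] at ht
      rw [(hderiv t).deriv]
      have := h t (le_of_lt ht)
      linarith
  have h0 : φ 0 = 0 := by simp [φ, expT_succ_zero]
  have := hmono (self_mem_Ici (a := (0 : ℝ))) (mem_Ici.mpr hy) hy
  rw [h0] at this
  simp only [φ] at this
  linarith

/-- **Alternating Taylor brackets**: `expT (2m) y ≤ e^{−y} ≤ expT (2m+1) y` for `y ≥ 0`. -/
theorem exp_neg_brackets : ∀ (m : ℕ) (y : ℝ), 0 ≤ y →
    expT (2 * m) y ≤ exp (-y) ∧ exp (-y) ≤ expT (2 * m + 1) y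
  | 0, y, hy => by
      refine ⟨by simpa [expT] using (exp_pos (-y)).le, ?_⟩
      have : expT 1 y = 1 := by simp [expT]
      rw [this]
      exact exp_le_one_iff.mpr (by linarith)
  | m + 1, y, hy => by
      have ih := fun z (hz : 0 ≤ z) => exp_neg_brackets m z hz
      have h1 := expT_le_exp_of_exp_le (2 * m + 1) (fun z hz => (ih z hz).2)
      have h2 := exp_le_expT_of_expT_le (2 * m + 2) (fun z hz => h1 z hz)
      exact ⟨h1 y hy, by simpa [show 2 * (m + 1) + 1 = 2 * m + 2 + 1 by ring] using h2 y hy⟩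

/-! ### `∫₀^R e^{−x^p} dx` between two explicit finite sums -/

/-- `gSum p n R = Σ_{k<n} (−1)^k R^{pk+1} / ((pk+1)·k!)` (`= ∫₀^R expT n (x^p) dx`). -/
noncomputable def gSum (p n : ℕ) (R : ℝ) : ℝ :=
  ∑ k ∈ range n, (-1) ^ k * R ^ (p * k + 1) / (((p * k + 1 : ℕ) : ℝ) * (k.factorial : ℝ))

/-- Termwise integration of the Taylor polynomial. -/
theorem integral_expT_pow (p n : ℕ) (R : ℝ) : ∫ x in (0 : ℝ)..R, expT n (x ^ p) = gSum p n R := by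
  unfold expT gSum
  rw [intervalIntegral.integral_finsetSum]
  · refine Finset.sum_congr rfl fun k _ => ?_
    have e : (fun x : ℝ => (-x ^ p) ^ k / (k.factorial : ℝ)) =
        fun x : ℝ => ((-1) ^ k / (k.factorial : ℝ)) * x ^ (p * k) := by
      funext x; rw [neg_pow, pow_mul]; ring
    rw [e, intervalIntegral.integral_const_mul, integral_pow,
      zero_pow (Nat.succ_ne_zero _), sub_zero]
    push_cast
    field_simp
  · intro k _
    exact (by fun_prop : Continuous fun x : ℝ => (-x ^ p) ^ k / (k.factorial : ℝ)).intervalIntegrable _ _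

/-- **Brackets for the finite part**: `gSum p (2m) R ≤ ∫₀^R e^{−x^p} ≤ gSum p (2m+1) R`. -/
theorem integral_exp_neg_pow_brackets (p m : ℕ) {R : ℝ} (hR : 0 ≤ R) :
    gSum p (2 * m) R ≤ ∫ x in (0 : ℝ)..R, exp (-x ^ p) ∧
      ∫ x in (0 : ℝ)..R, exp (-x ^ p) ≤ gSum p (2 * m + 1) R := by
  rw [← integral_expT_pow, ← integral_expT_pow]
  have hc : ∀ n, IntervalIntegrable (fun x : ℝ => expT n (x ^ p)) volume 0 R := fun n =>
    ((continuous_expT n).comp (continuous_pow p)).intervalIntegrable _ _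
  have he : IntervalIntegrable (fun x : ℝ => exp (-x ^ p)) volume 0 R :=
    (by fun_prop : Continuous fun x : ℝ => exp (-x ^ p)).intervalIntegrable _ _
  exact ⟨intervalIntegral.integral_mono_on hR (hc _) he
      fun x hx => (exp_neg_brackets m (x ^ p) (pow_nonneg hx.1 _)).1,
    intervalIntegral.integral_mono_on hR he (hc _)
      fun x hx => (exp_neg_brackets m (x ^ p) (pow_nonneg hx.1 _)).2⟩

/-! ### The improper part: integrability, splitting at `R`, and the tail -/

/-- `e^{−x^p}` is integrable on `(0, ∞)` (`p ≥ 1`; dominated by `e·e^{−x}`). -/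
theorem integrableOn_exp_neg_pow (p : ℕ) (hp : 1 ≤ p) :
    IntegrableOn (fun x : ℝ => exp (-x ^ p)) (Ioi 0) := by
  have hg : IntegrableOn (fun x : ℝ => exp 1 * exp (-x)) (Ioi 0) := (integrableOn_exp_neg_Ioi 0).const_mul _
  refine hg.mono' (by fun_prop : Continuous fun x : ℝ => exp (-x ^ p)).aestronglyMeasurable ?_
  refine (ae_restrict_iff' measurableSet_Ioi).mpr (Eventually.of_forall fun x hx => ?_)
  rw [Real.norm_eq_abs, abs_of_pos (exp_pos _), ← exp_add, exp_le_exp]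
  have hx : 0 < x := hx
  rcases le_or_gt x 1 with h1 | h1
  · have : 0 ≤ x ^ p := pow_nonneg hx.le _
    linarith
  · have : x ≤ x ^ p := le_self_pow₀ h1.le (by omega)
    linarith

/-- Splitting `∫_{(0,∞)} = ∫₀^R + ∫_{(R,∞)}`. -/
theorem integral_Ioi_exp_neg_pow_split (p : ℕ) (hp : 1 ≤ p) {R : ℝ} (hR : 0 ≤ R) :
    ∫ x in Ioi (0 : ℝ), exp (-x ^ p) =
      (∫ x in (0 : ℝ)..R, exp (-x ^ p)) + ∫ x in Ioi R, exp (-x ^ p) := by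
  have hint := integrableOn_exp_neg_pow p hp
  have hdisj : Disjoint (Ioc (0 : ℝ) R) (Ioi R) :=
    Set.disjoint_left.mpr fun x hx hx' => (not_lt.mpr hx.2) hx'
  rw [← Ioc_union_Ioi_eq_Ioi hR, setIntegral_union hdisj measurableSet_Ioi
    (hint.mono_set Ioc_subset_Ioi_self) (hint.mono_set (Ioi_subset_Ioi hR)),
    intervalIntegral.integral_of_le hR]

/-- **Tail bound**: `0 ≤ ∫_{(R,∞)} e^{−x^p} ≤ e^{−R^p}/(p R^{p−1})` (from `e^{−x^p} ≤ (x/R)^{p−1} e^{−x^p}`). -/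
theorem integral_Ioi_exp_neg_pow_tail (p : ℕ) (hp : 1 ≤ p) {R : ℝ} (hR : 0 < R) :
    0 ≤ ∫ x in Ioi R, exp (-x ^ p) ∧
      ∫ x in Ioi R, exp (-x ^ p) ≤ exp (-R ^ p) / (p * R ^ (p - 1)) := by
  have hint : IntegrableOn (fun x : ℝ => exp (-x ^ p)) (Ioi R) :=
    (integrableOn_exp_neg_pow p hp).mono_set (Ioi_subset_Ioi hR.le)
  refine ⟨setIntegral_nonneg measurableSet_Ioi fun x _ => (exp_pos _).le, ?_⟩
  set c : ℝ := (p : ℝ) * R ^ (p - 1) with hc_def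
  have hp0 : (0 : ℝ) < p := by exact_mod_cast hp
  have hc : 0 < c := by positivity
  -- `F x = −e^{−x^p}/c` has derivative `p x^{p−1} e^{−x^p}/c ≥ e^{−x^p}` on `(R, ∞)` and tends to `0`
  have hF : ∀ x ∈ Ioi R, HasDerivAt (fun x : ℝ => -exp (-x ^ p) / c)
      ((p : ℝ) * x ^ (p - 1) * exp (-x ^ p) / c) x := by
    intro x _
    have h1 : HasDerivAt (fun x : ℝ => -x ^ p) (-((p : ℝ) * x ^ (p - 1))) x := (hasDerivAt_pow p x).neg
    exact ((h1.exp.neg).div_const c).congr_deriv (by ring)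
  have hcont : ContinuousWithinAt (fun x : ℝ => -exp (-x ^ p) / c) (Ici R) R :=
    (by fun_prop : Continuous fun x : ℝ => -exp (-x ^ p) / c).continuousWithinAt
  have hlim : Tendsto (fun x : ℝ => -exp (-x ^ p) / c) atTop (𝓝 (-0 / c)) := by
    refine ((tendsto_exp_atBot.comp ?_).neg).div_const c
    exact tendsto_neg_atTop_atBot.comp (tendsto_pow_atTop (by omega))
  have hpos : ∀ x ∈ Ioi R, 0 ≤ (p : ℝ) * x ^ (p - 1) * exp (-x ^ p) / c := fun x hx => by
    have : 0 < x := hR.trans hx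
    positivity
  have hFint := integrableOn_Ioi_deriv_of_nonneg hcont hF hpos hlim
  have hI := integral_Ioi_of_hasDerivAt_of_tendsto hcont hF hFint hlim
  have hmono : ∫ x in Ioi R, exp (-x ^ p) ≤ ∫ x in Ioi R, (p : ℝ) * x ^ (p - 1) * exp (-x ^ p) / c := by
    refine setIntegral_mono_on hint hFint measurableSet_Ioi fun x hx => ?_
    have hx' : R ≤ x := le_of_lt hx
    have hRp : R ^ (p - 1) ≤ x ^ (p - 1) := pow_le_pow_left₀ hR.le hx' _
    rw [le_div_iff₀ hc, hc_def]
    have he : 0 < exp (-x ^ p) := exp_pos _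
    nlinarith [mul_le_mul_of_nonneg_left hRp (by positivity : (0 : ℝ) ≤ p * exp (-x ^ p))]
  rw [hI] at hmono
  have e : -0 / c - -exp (-R ^ p) / c = exp (-R ^ p) / c := by ring
  rwa [e] at hmono

/-- **`Γ(1/p) = p ∫_{(0,∞)} e^{−x^p} dx`** (substitution `y = x^p` in `Real.Gamma_eq_integral`). -/
theorem Gamma_one_div_eq (p : ℕ) (hp : 1 ≤ p) :
    Real.Gamma (1 / p) = p * ∫ x in Ioi (0 : ℝ), exp (-x ^ p) := by
  have hp0 : (0 : ℝ) < p := by exact_mod_cast hp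
  rw [Real.Gamma_eq_integral (by positivity)]
  have h := integral_comp_rpow_Ioi_of_pos (g := fun y : ℝ => exp (-y) * y ^ ((1 : ℝ) / p - 1)) hp0
  rw [← h]
  have e : EqOn (fun x : ℝ => ((p : ℝ) * x ^ ((p : ℝ) - 1)) • (exp (-x ^ (p : ℝ)) * (x ^ (p : ℝ)) ^ ((1 : ℝ) / p - 1)))
      (fun x : ℝ => (p : ℝ) * exp (-x ^ p)) (Ioi 0) := by
    intro x hx
    have hx0 : 0 < x := hx
    simp only [smul_eq_mul]
    rw [← Real.rpow_mul hx0.le, Real.rpow_natCast]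
    have hq : (p : ℝ) * ((1 : ℝ) / p - 1) = 1 - p := by field_simp
    rw [hq]
    have hxp : x ^ ((p : ℝ) - 1) * x ^ ((1 : ℝ) - p) = 1 := by
      rw [← Real.rpow_add hx0]; norm_num
    calc (p : ℝ) * x ^ ((p : ℝ) - 1) * (exp (-x ^ p) * x ^ ((1 : ℝ) - p))
        = p * exp (-x ^ p) * (x ^ ((p : ℝ) - 1) * x ^ ((1 : ℝ) - p)) := by ring
      _ = p * exp (-x ^ p) := by rw [hxp, mul_one]
  rw [setIntegral_congr_fun measurableSet_Ioi e, MeasureTheory.integral_const_mul]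

/-- **Two-sided bounds for `Γ(1/p)`** from `2m` / `2m+1` Taylor terms on `[0, R]` and the tail bound. -/
theorem Gamma_one_div_bounds (p m : ℕ) (hp : 1 ≤ p) {R : ℝ} (hR : 0 < R) :
    (p : ℝ) * gSum p (2 * m) R ≤ Real.Gamma (1 / p) ∧
      Real.Gamma (1 / p) ≤ p * (gSum p (2 * m + 1) R + exp (-R ^ p) / (p * R ^ (p - 1))) := by
  have hp0 : (0 : ℝ) ≤ p := by positivity
  rw [Gamma_one_div_eq p hp, integral_Ioi_exp_neg_pow_split p hp hR.le]
  obtain ⟨h1, h2⟩ := integral_exp_neg_pow_brackets p m hR.le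
  obtain ⟨h3, h4⟩ := integral_Ioi_exp_neg_pow_tail p hp hR
  constructor
  · exact mul_le_mul_of_nonneg_left (by linarith) hp0
  · exact mul_le_mul_of_nonneg_left (by linarith) hp0

/-! ### Numerics: `Γ(¼)` with `R = 11/5`, 90 / 91 Taylor terms; `Γ(⅓)` with `R = 29/10`, 100 / 101 terms -/

/-- Rational twin of `gSum`. -/
def gSumQ (p n : ℕ) (R : ℚ) : ℚ :=
  ∑ k ∈ range n, (-1) ^ k * R ^ (p * k + 1) / (((p * k + 1 : ℕ) : ℚ) * (k.factorial : ℚ))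

/-- `gSumQ` casts to `gSum`. -/
theorem gSumQ_cast (p n : ℕ) (R : ℚ) : ((gSumQ p n R : ℚ) : ℝ) = gSum p n R := by
  simp only [gSumQ, gSum]
  push_cast
  rfl

/-- Rational lower bound of `e^{y}`: `Σ_{i<n} y^i/i!`. -/
def expLowQ (n : ℕ) (y : ℚ) : ℚ := ∑ i ∈ range n, y ^ i / (i.factorial : ℚ)

/-- `expLowQ n y ≤ e^{y}` for `y ≥ 0` (`Real.sum_le_exp_of_nonneg`). -/
theorem expLowQ_le_exp (n : ℕ) {y : ℚ} (hy : 0 ≤ y) : ((expLowQ n y : ℚ) : ℝ) ≤ exp y := by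
  have h := Real.sum_le_exp_of_nonneg (x := (y : ℝ)) (by exact_mod_cast hy) n
  simp only [expLowQ]
  push_cast
  exact h

/-- The tail bound in rationals: `e^{−R^p}/(p R^{p−1}) ≤ (1 / expLowQ N (R^p)) / (p R^{p−1})`. -/
theorem tail_le_rat (p N : ℕ) {R : ℚ} (hR : 0 < R) (hp : 1 ≤ p) (hL : 0 < expLowQ N (R ^ p)) :
    exp (-(R : ℝ) ^ p) / (p * (R : ℝ) ^ (p - 1)) ≤ (((1 / expLowQ N (R ^ p)) / (p * R ^ (p - 1)) : ℚ) : ℝ) := by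
  have h1 := expLowQ_le_exp N (y := R ^ p) (by positivity)
  have hL' : (0 : ℝ) < (expLowQ N (R ^ p) : ℚ) := by exact_mod_cast hL
  have hR' : (0 : ℝ) < R := by exact_mod_cast hR
  have hp0 : (0 : ℝ) < p := by exact_mod_cast hp
  push_cast at h1 ⊢
  rw [Real.exp_neg, one_div]
  exact div_le_div_of_nonneg_right (inv_anti₀ hL' h1) (by positivity)

/-- The certified enclosure of `Γ(¼)`: `[3.6256099082157, 3.6256099082221]` (width `6.4·10⁻¹²`). -/
def gammaQuarterI : ℚ × ℚ := (36256099082157 / 10 ^ 13, 36256099082221 / 10 ^ 13)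

/-- **`Γ(¼) ∈ gammaQuarterI`** (`p = 4`, `R = 11/5`, Taylor orders `90/91`, `e^{R⁴} ≥ expLowQ 60`). -/
theorem gamma_quarter_mem : Real.Gamma (1 / 4) ∈ InI gammaQuarterI := by
  obtain ⟨h1, h2⟩ := Gamma_one_div_bounds 4 45 (by norm_num) (R := ((11 / 5 : ℚ) : ℝ)) (by positivity)
  simp only [Nat.cast_ofNat] at h1 h2
  rw [← gSumQ_cast] at h1 h2
  have ht := tail_le_rat 4 60 (R := 11 / 5) (by norm_num) (by norm_num) (by decide +kernel)
  simp only [Nat.cast_ofNat] at ht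
  have q1 : (36256099082157 / 10 ^ 13 : ℚ) ≤ 4 * gSumQ 4 (2 * 45) (11 / 5) := by decide +kernel
  have q2 : 4 * (gSumQ 4 (2 * 45 + 1) (11 / 5) + (1 / expLowQ 60 ((11 / 5) ^ 4)) / (4 * (11 / 5) ^ (4 - 1))) ≤
      (36256099082221 / 10 ^ 13 : ℚ) := by decide +kernel
  have q1' := Rat.cast_le (K := ℝ).mpr q1
  have q2' := Rat.cast_le (K := ℝ).mpr q2
  push_cast at q1' q2' ht h1 h2
  refine ⟨?_, ?_⟩
  · simp only [gammaQuarterI]; push_cast; linarith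
  · simp only [gammaQuarterI]; push_cast; linarith

/-- The certified enclosure of `Γ(⅓)`: `[2.6789385347047, 2.6789385347079]` (width `3.2·10⁻¹²`). -/
def gammaThirdI : ℚ × ℚ := (26789385347047 / 10 ^ 13, 26789385347079 / 10 ^ 13)

/-- **`Γ(⅓) ∈ gammaThirdI`** (`p = 3`, `R = 29/10`, Taylor orders `100/101`, `e^{R³} ≥ expLowQ 64`). -/
theorem gamma_third_mem : Real.Gamma (1 / 3) ∈ InI gammaThirdI := by
  obtain ⟨h1, h2⟩ := Gamma_one_div_bounds 3 50 (by norm_num) (R := ((29 / 10 : ℚ) : ℝ)) (by positivity)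
  simp only [Nat.cast_ofNat] at h1 h2
  rw [← gSumQ_cast] at h1 h2
  have ht := tail_le_rat 3 64 (R := 29 / 10) (by norm_num) (by norm_num) (by decide +kernel)
  simp only [Nat.cast_ofNat] at ht
  have q1 : (26789385347047 / 10 ^ 13 : ℚ) ≤ 3 * gSumQ 3 (2 * 50) (29 / 10) := by decide +kernel
  have q2 : 3 * (gSumQ 3 (2 * 50 + 1) (29 / 10) + (1 / expLowQ 64 ((29 / 10) ^ 3)) / (3 * (29 / 10) ^ (3 - 1))) ≤
      (26789385347079 / 10 ^ 13 : ℚ) := by decide +kernel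
  have q1' := Rat.cast_le (K := ℝ).mpr q1
  have q2' := Rat.cast_le (K := ℝ).mpr q2
  push_cast at q1' q2' ht h1 h2
  refine ⟨?_, ?_⟩
  · simp only [gammaThirdI]; push_cast; linarith
  · simp only [gammaThirdI]; push_cast; linarith

end Summit.CriticalPhenomena.Ising3D
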